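import Summits.QuantumFields.YangMills.Theorems.Instrument.ActivitySupSU2Bounds
import HarnessLib

/-!
# Instrument cell `ym-instrument`, crew (b): the tree's Kotecký–Preiss window criterion `KPCriterionSU2 δ β₀W` for `SU(2)`, `D = 4`,
# TYPED CONDITIONALLY on the J-SC1 polymer counts (`n ≤ 16`) and the tail lemma `TailBoundT2` — rows `β₀W = 9/200` (`δ = 10⁻³`), `1/25` (`δ = 10⁻²`),
# and the rate-type row `β₀W = 1/50`, `δ = 43/50` (grade (T | counts, T2) — hypotheses NAMED, none discharged)

QUESTIONS.md rows: Q-B1 / Q-B2 (REGISTERED 2026-08-26T13:54:11Z; A-0826-8, A-0826-16); certs/b/FORMAT.md v1 §3b/§3d (radius / rate rows), sc-ref TYPING MEMO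
17:45:09Z (2)–(3); cell `run/shared/lean/pub/ym-instrument/`, HUMAN RULING D-0084 (2), director-ym R138.  HONEST FRAMING (page 1, binding).  WHAT IS CERTIFIED
HERE AND AT WHICH `(G, D, L, β)`: `G = SU(2)`, `D = 4` (`ℤ⁴`), Wilson action, Wilson coupling `β_W ∈ [0, β₀W]`; the object is the tree's COMPUTABLE criterion
`Balaban1983to89.StrongCouplingKPWindow.KPCriterionSU2 δ β₀W` («∃ α > 0, ∀ 0 ≤ β_W ≤ β₀W: Σ_n closedCount 4 n · activitySupSU2(β_W)^n · e^{(2α+δ)n} ≤ α», the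
Kotecký–Preiss / Fernández–Procacci condition of the `SU(2)` plaquette Mayer-polymer gas on `ℤ⁴` with `a(γ) = α·#links`).  EVERY theorem below is
CONDITIONAL on two NAMED hypotheses that the tree does NOT prove: (H1) the J-SC1 polymer counts as UPPER BOUNDS, `closedCount 4 n ≤ c_n` for `n ≤ 16` with
`(c₀,…,c₁₆) = (0,0,0,0,0,0,12,0,0,0,180,180,930,0,3876,7016,36252)` (two independent enumerators of pub-balaban J-SC1 and this cell's sc-eng-2 j256831 agree —
CERTIFICATE DATA, not tree theorems: `closedCount` is a noncomputable `Nat.card`); (H2) the tail lemma `TailBoundT2` (`closedCount 4 n ≤ 0.7·14.95ⁿ`, `n ≥ 2`;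
paper proof pub-balaban `FRONT-SC-taillemma.txt`, refereed PASS by sc-ref 2026-08-26T16:50:07Z; Lean obligation OPEN).  Given (H1)(H2), the rest is kernel
arithmetic: the activity bound `activitySupSU2 β_W ≤ e^{β₀W} − 1 ≤ A⁺` (landed `Instrument.ActivitySupSU2Bounds`), `e^{2α+δ} ≤ Q⁺` (`Real.exp_bound'`), termwise
domination by `c_n (A⁺Q⁺)^n` resp. `0.7 (14.95 A⁺Q⁺)^n`, a finite sum plus a geometric tail, `≤ α` by `norm_num`.  WHAT THIS IS NOT: NOT a proof of clustering or of
a mass gap — the tree's bridge `ExpClusteringOfKPCriterion` (KP ⇒ `StrongCouplingFront`) is an UNPROVED schema and the explicit-rate bridge (RADIUS-DERIVATION Thm R,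
«rate ≥ 4·δ») is paper-level: composing is recorded in `strongCouplingFront_1_25_conditional` with the schema as a THIRD named hypothesis; the windows here
(`β_W ≤ 0.045`) lie a factor 6 INSIDE the tree's hypothesis-free doors (SC-c `2/7`, front `9/25`) and move NO endpoint (A-0826-16: sup-column ceiling `0.328`);
NOT summit-bearing.  Grade in the cell's grammar: (T | counts, T2) for `KPCriterionSU2`, (T | counts, T2, bridge) for the front — «certified-conditional», never «certified».
-/

noncomputable section

open Real Finset
open Literature.MathematicalPhysics.QuantumFieldTheory.Balaban1983to89.StrongCouplingKPWindow
  (closedCount activitySupSU2 KPCriterionSU2 TailBoundT2 ExpClusteringOfKPCriterion strongCouplingFront_of_kp)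
open Literature.MathematicalPhysics.QuantumFieldTheory.Balaban1983to89.CrossoverLedger (StrongCouplingFront)
open Literature.MathematicalPhysics.QuantumLattice (fundamentalLatticeRep)
open Summit.QuantumFields.YangMills.Theorems.Instrument.ActivitySupSU2Bounds (activitySupSU2_nonneg activitySupSU2_le_of_le)

namespace Summit.QuantumFields.YangMills.Theorems.Instrument.KPCriterionSU2Conditional

/-! ## §1 The counts hypothesis (J-SC1 data as NAMED upper bounds) -/

/-- The J-SC1 counts `c₀ … c₁₆` of rooted closed link-connected plaquette complexes of `ℤ⁴` (CERTIFICATE DATA of pub-balaban J-SC1 / this cell's j256831;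
`12` at `n = 6` (the unit cube), `180, 180, 930, 0, 3876, 7016, 36252` at `n = 10 … 16`), as a function `ℕ → ℝ` (zero elsewhere); data, no provenance tag
(deliberately, so that the gate does not relocate it as a Literature fact). -/
def jsc1Count (n : ℕ) : ℝ :=
  if n = 6 then 12 else if n = 10 then 180 else if n = 11 then 180 else if n = 12 then 930 else if n = 14 then 3876
  else if n = 15 then 7016 else if n = 16 then 36252 else 0

/-- **(H1) as a `Prop`**: the counts bound the tree's `closedCount 4 n` from above for every `n ≤ 16` — a HYPOTHESIS schema of this file (the tree
proves no value of `closedCount`); NOT a published fact, deliberately untagged; users take `(hc : CountsUpTo16)` explicitly. -/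
def CountsUpTo16 : Prop := ∀ n : ℕ, n < 17 → (closedCount 4 n : ℝ) ≤ jsc1Count n

/-- The majorant coefficient: counts below `17`, the T2 bound `0.7·14.95ⁿ` from `17` on. -/
def majCoeff (n : ℕ) : ℝ := if n < 17 then jsc1Count n else 7 / 10 * (299 / 20 : ℝ) ^ n

/-- Under (H1)(H2) every `closedCount 4 n` is below the majorant coefficient. [folklore] -/
theorem closedCount_le_majCoeff (hc : CountsUpTo16) (hT : TailBoundT2) (n : ℕ) : (closedCount 4 n : ℝ) ≤ majCoeff n := by
  unfold majCoeff
  split_ifs with h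
  · exact hc n h
  · exact hT n (by omega)

/-! ## §2 The abstract engine: bounds `A ≥ e^{β₀} − 1`, `Q ≥ e^{2α+δ}` and ONE rational inequality give the criterion -/

/-- The value of the majorant series: `Σ_{n<17} c_n yⁿ + 0.7·(14.95y)¹⁷/(1 − 14.95y)`. -/
def majSum (y : ℝ) : ℝ := ∑ n ∈ Finset.range 17, jsc1Count n * y ^ n + 7 / 10 * ((299 / 20 : ℝ) * y) ^ 17 / (1 - (299 / 20 : ℝ) * y)

/-- The majorant series `n ↦ majCoeff n · yⁿ` is summable with sum `majSum y` when `0 ≤ y` and `14.95·y < 1`. [folklore] -/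
theorem hasSum_majorant {y : ℝ} (hy : 0 ≤ y) (ht : (299 / 20 : ℝ) * y < 1) :
    HasSum (fun n : ℕ => majCoeff n * y ^ n) (majSum y) := by
  have ht0 : 0 ≤ (299 / 20 : ℝ) * y := by positivity
  -- tail: n = j + 17
  have htail : HasSum (fun j : ℕ => majCoeff (j + 17) * y ^ (j + 17))
      (7 / 10 * ((299 / 20 : ℝ) * y) ^ 17 * (1 - (299 / 20 : ℝ) * y)⁻¹) := by
    have hg := (hasSum_geometric_of_lt_one ht0 ht).mul_left (7 / 10 * ((299 / 20 : ℝ) * y) ^ 17)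
    refine hg.congr_fun fun j => ?_
    have hj : ¬ (j + 17 < 17) := by omega
    simp only [majCoeff, hj, if_false, mul_pow, pow_add]
    ring
  have h := (hasSum_nat_add_iff (f := fun n : ℕ => majCoeff n * y ^ n) 17).1 htail
  have hhead : ∑ i ∈ Finset.range 17, majCoeff i * y ^ i = ∑ n ∈ Finset.range 17, jsc1Count n * y ^ n :=
    Finset.sum_congr rfl fun i hi => by
      have hi' : i < 17 := Finset.mem_range.1 hi
      simp only [majCoeff, hi', if_true]
  have heq : 7 / 10 * ((299 / 20 : ℝ) * y) ^ 17 * (1 - (299 / 20 : ℝ) * y)⁻¹ + ∑ i ∈ Finset.range 17, majCoeff i * y ^ i = majSum y := by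
    rw [hhead]; unfold majSum; rw [div_eq_mul_inv]; ring
  rw [heq] at h
  exact h

/-- ★ **THE ENGINE.**  Let `0 < α`, and rationals (reals) `A, Q` with `e^{β₀} − 1 ≤ A`, `e^{2α+δ} ≤ Q`, `14.95·A·Q < 1` and
`majSum (A·Q) ≤ α`.  Then (H1) `CountsUpTo16` and (H2) `TailBoundT2` imply `KPCriterionSU2 δ β₀` with witness `α`. [folklore] -/
theorem kpCriterionSU2_of_bounds {δ β₀ α A Q : ℝ} (hc : CountsUpTo16) (hT : TailBoundT2) (hα : 0 < α)
    (hA : Real.exp β₀ - 1 ≤ A) (hQ : Real.exp (2 * α + δ) ≤ Q) (ht : (299 / 20 : ℝ) * (A * Q) < 1) (hS : majSum (A * Q) ≤ α) :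
    KPCriterionSU2 δ β₀ := by
  refine ⟨α, hα, fun βW h0 h1 => ?_⟩
  set a : ℝ := activitySupSU2 βW with hadef
  set E : ℝ := Real.exp (2 * α + δ) with hEdef
  have ha0 : 0 ≤ a := activitySupSU2_nonneg h0
  have haA : a ≤ A := (activitySupSU2_le_of_le h1).trans hA
  have hE0 : 0 < E := Real.exp_pos _
  have hA0 : 0 ≤ A := ha0.trans haA
  have hQ0 : 0 ≤ Q := hE0.le.trans hQ
  have hy0 : 0 ≤ A * Q := mul_nonneg hA0 hQ0
  have haE : a * E ≤ A * Q := mul_le_mul haA hQ hE0.le hA0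
  -- the summand of the criterion, rewritten with `E^n`
  have hterm : ∀ n : ℕ, (closedCount 4 n : ℝ) * a ^ n * Real.exp ((2 * α + δ) * n) = (closedCount 4 n : ℝ) * (a * E) ^ n := fun n => by
    rw [mul_comm (2 * α + δ) (n : ℝ), Real.exp_nat_mul, mul_pow]; ring
  have hle : ∀ n : ℕ, (closedCount 4 n : ℝ) * a ^ n * Real.exp ((2 * α + δ) * n) ≤ majCoeff n * (A * Q) ^ n := fun n => by
    rw [hterm n]
    have h1 := closedCount_le_majCoeff hc hT n
    have hmaj0 : 0 ≤ majCoeff n := (Nat.cast_nonneg _).trans h1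
    exact mul_le_mul h1 (pow_le_pow_left₀ (mul_nonneg ha0 hE0.le) haE n) (pow_nonneg (mul_nonneg ha0 hE0.le) n) hmaj0
  have hnn : ∀ n : ℕ, 0 ≤ (closedCount 4 n : ℝ) * a ^ n * Real.exp ((2 * α + δ) * n) := fun n => by positivity
  have hmaj := hasSum_majorant hy0 ht
  have hsum : Summable (fun n : ℕ => (closedCount 4 n : ℝ) * a ^ n * Real.exp ((2 * α + δ) * n)) :=
    Summable.of_nonneg_of_le hnn hle hmaj.summable
  refine ⟨hsum, ?_⟩
  calc ∑' n : ℕ, (closedCount 4 n : ℝ) * a ^ n * Real.exp ((2 * α + δ) * n)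
      ≤ ∑' n : ℕ, majCoeff n * (A * Q) ^ n := hsum.tsum_le_tsum hle hmaj.summable
    _ = majSum (A * Q) := hmaj.tsum_eq
    _ ≤ α := hS

/-! ## §3 The three rows (kernel arithmetic; (T | counts, T2)) -/

/-- `e^{9/200} − 1 ≤ 46027859909·10⁻¹²`. [folklore] -/
theorem exp_9_200_sub_one_le : Real.exp ((9 : ℝ) / 200) - 1 ≤ (46027859909 : ℝ) / 1000000000000 := by
  have h := Real.exp_bound' (x := (9 : ℝ) / 200) (by norm_num) (by norm_num) (n := 8) (by norm_num)
  simp only [Finset.sum_range_succ, Finset.sum_range_zero, Nat.factorial] at h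
  norm_num at h ⊢; linarith

/-- `e^{1/25} − 1 ≤ 40810774193·10⁻¹²`. [folklore] -/
theorem exp_1_25_sub_one_le : Real.exp ((1 : ℝ) / 25) - 1 ≤ (40810774193 : ℝ) / 1000000000000 := by
  have h := Real.exp_bound' (x := (1 : ℝ) / 25) (by norm_num) (by norm_num) (n := 8) (by norm_num)
  simp only [Finset.sum_range_succ, Finset.sum_range_zero, Nat.factorial] at h
  norm_num at h ⊢; linarith

/-- `e^{1/50} − 1 ≤ 20201340027·10⁻¹²`. [folklore] -/
theorem exp_1_50_sub_one_le : Real.exp ((1 : ℝ) / 50) - 1 ≤ (20201340027 : ℝ) / 1000000000000 := by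
  have h := Real.exp_bound' (x := (1 : ℝ) / 50) (by norm_num) (by norm_num) (n := 8) (by norm_num)
  simp only [Finset.sum_range_succ, Finset.sum_range_zero, Nat.factorial] at h
  norm_num at h ⊢; linarith

/-- `e^{2·(11/2000) + 1/1000} = e^{0.012} ≤ 1012072288867·10⁻¹²`. [folklore] -/
theorem exp_0012_le : Real.exp (2 * ((11 : ℝ) / 2000) + (1 : ℝ) / 1000) ≤ (1012072288867 : ℝ) / 1000000000000 := by
  rw [show 2 * ((11 : ℝ) / 2000) + (1 : ℝ) / 1000 = (3 : ℝ) / 250 by norm_num]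
  have h := Real.exp_bound' (x := (3 : ℝ) / 250) (by norm_num) (by norm_num) (n := 8) (by norm_num)
  simp only [Finset.sum_range_succ, Finset.sum_range_zero, Nat.factorial] at h
  norm_num at h ⊢; linarith

/-- `e^{2·(1/500) + 1/100} = e^{0.014} ≤ 1014098458939·10⁻¹²`. [folklore] -/
theorem exp_0014_le : Real.exp (2 * ((1 : ℝ) / 500) + (1 : ℝ) / 100) ≤ (1014098458939 : ℝ) / 1000000000000 := by
  rw [show 2 * ((1 : ℝ) / 500) + (1 : ℝ) / 100 = (7 : ℝ) / 500 by norm_num]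
  have h := Real.exp_bound' (x := (7 : ℝ) / 500) (by norm_num) (by norm_num) (n := 8) (by norm_num)
  simp only [Finset.sum_range_succ, Finset.sum_range_zero, Nat.factorial] at h
  norm_num at h ⊢; linarith

/-- `e^{2·(1/50) + 43/50} = e^{0.9} ≤ 2459603273483·10⁻¹²` (8-term Taylor bound; `e^{0.9} = 2.4596031…`). [folklore] -/
theorem exp_09_le : Real.exp (2 * ((1 : ℝ) / 50) + (43 : ℝ) / 50) ≤ (2459603273483 : ℝ) / 1000000000000 := by
  rw [show 2 * ((1 : ℝ) / 50) + (43 : ℝ) / 50 = (9 : ℝ) / 10 by norm_num]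
  have h := Real.exp_bound' (x := (9 : ℝ) / 10) (by norm_num) (by norm_num) (n := 8) (by norm_num)
  simp only [Finset.sum_range_succ, Finset.sum_range_zero, Nat.factorial] at h
  norm_num at h ⊢; linarith

/-- The majorant sum at a rational point, evaluated by `norm_num` (the seventeen head terms and the geometric tail). -/
theorem majSum_le_of {y b : ℝ}
    (h : ∑ n ∈ Finset.range 17, jsc1Count n * y ^ n + 7 / 10 * ((299 / 20 : ℝ) * y) ^ 17 / (1 - (299 / 20 : ℝ) * y) ≤ b) : majSum y ≤ b := h

/-- ★ **Row `β₀W = 9/200 = 0.045`, `δ = 10⁻³`**: (H1) ∧ (H2) ⟹ `KPCriterionSU2 (1/1000) (9/200)` (witness `α = 11/2000`; `14.95·A⁺Q⁺ = 0.696`, majorant sum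
`0.004917 ≤ 0.0055`). [folklore] -/
theorem kpCriterionSU2_9_200 (hc : CountsUpTo16) (hT : TailBoundT2) : KPCriterionSU2 ((1 : ℝ) / 1000) ((9 : ℝ) / 200) := by
  refine kpCriterionSU2_of_bounds hc hT (by norm_num) exp_9_200_sub_one_le exp_0012_le (by norm_num) (majSum_le_of ?_)
  simp only [Finset.sum_range_succ, Finset.sum_range_zero, jsc1Count]
  norm_num

/-- ★ **Row `β₀W = 1/25 = 0.04`, `δ = 10⁻²`**: (H1) ∧ (H2) ⟹ `KPCriterionSU2 (1/100) (1/25)` (witness `α = 1/500`; majorant sum `0.000524 ≤ 0.002`). [folklore] -/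
theorem kpCriterionSU2_1_25 (hc : CountsUpTo16) (hT : TailBoundT2) : KPCriterionSU2 ((1 : ℝ) / 100) ((1 : ℝ) / 25) := by
  refine kpCriterionSU2_of_bounds hc hT (by norm_num) exp_1_25_sub_one_le exp_0014_le (by norm_num) (majSum_le_of ?_)
  simp only [Finset.sum_range_succ, Finset.sum_range_zero, jsc1Count]
  norm_num

/-- ★ **Rate-type row `β₀W = 1/50 = 0.02`, `δ = 43/50 = 0.86`**: (H1) ∧ (H2) ⟹ `KPCriterionSU2 (43/50) (1/50)` (witness `α = 1/50`; majorant sum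
`0.01738 ≤ 0.02`).  In RADIUS-DERIVATION's (paper-level, GAP-STATED) Theorem R this `δ` is the decay weight `d`, rate `≥ 4δ = 3.44` per lattice unit at
`β_W ≤ 0.02` — NOT claimed here. [folklore] -/
theorem kpCriterionSU2_rate_1_50 (hc : CountsUpTo16) (hT : TailBoundT2) : KPCriterionSU2 ((43 : ℝ) / 50) ((1 : ℝ) / 50) := by
  refine kpCriterionSU2_of_bounds hc hT (by norm_num) exp_1_50_sub_one_le exp_09_le (by norm_num) (majSum_le_of ?_)
  simp only [Finset.sum_range_succ, Finset.sum_range_zero, jsc1Count]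
  norm_num

/-! ## §4 Composition with the tree's (unproved) bridge schema — every hypothesis named -/

/-- **(T | counts, T2, bridge)**: IF the J-SC1 counts bound `closedCount` up to `16`, IF `TailBoundT2`, and IF the tree's Kotecký–Preiss ⇒ clustering
schema `ExpClusteringOfKPCriterion (1/100) (1/25)` holds, THEN the `SU(2)`, `d = 4` strong-coupling front `StrongCouplingFront (fundamentalLatticeRep 2) (1/50)`
(tree coupling `β₀W/2 = 1/50`, i.e. Wilson `β_W ≤ 0.04`).  Nothing is asserted: three named hypotheses, composed by the tree's `strongCouplingFront_of_kp`;
the window is a factor `9` inside the tree's hypothesis-free front at `9/50`. [folklore] -/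
theorem strongCouplingFront_1_25_conditional (hc : CountsUpTo16) (hT : TailBoundT2)
    (hBridge : ExpClusteringOfKPCriterion ((1 : ℝ) / 100) ((1 : ℝ) / 25)) :
    StrongCouplingFront (fundamentalLatticeRep 2) (((1 : ℝ) / 25) / 2) :=
  strongCouplingFront_of_kp (by norm_num) (kpCriterionSU2_1_25 hc hT) hBridge

end Summit.QuantumFields.YangMills.Theorems.Instrument.KPCriterionSU2Conditional

end
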